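import Summits.BirchSwinnertonDyer.BirchSwinnertonDyer.Theorems.ManinLocalTwoThreeManinPrimeToThreeAtNineInhabited
import Literature.NumberTheory.EllipticCurves.ModularCurveNonempty
import HarnessLib

/-!
# The newform at level 36 is `φ₃₆ = η(6τ)⁴`: `D.f = φ₃₆` for every `X₀(36)`-datum — FACT-FREE

Cell bsd-f2-manin, route `ManinLocalTwoThree` (cruxes C2 `ManinOddAtFour` stmt-22967 — `4 ∣ 36` — and C3
`ManinPrimeToThreeAtNine` stmt-22968 — `9 ∣ 36`), prover seat p2 gen 26; first file of the level-`36` run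
of the hexagonal-squeeze architecture (`N = 27`: p3 g22 `NonVacuityTwentySeven` §2; `N = 32`: -an g49 §94.8).

`S₂(Γ₀(36))` is the line spanned by `φ₃₆ = η(6τ)⁴` (tree: `cuspFormEtaProductThirtySix`,
`finrank_cuspForm_two_eq_genusX0_thirtySix`).  Here: `a₁(φ₃₆) = 1` from the `η`-asymptotics `φ₃₆/q → 1`
(`cuspCoeff_one_etaProductThirtySix`); `S₂(Γ₀(M)) = 0` for every proper divisor `M` of `36` (genus `0`),
so every form of level `36` is new; the line is Hecke-stable, so every non-zero form is an eigenform;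
hence **`IsNewform0 φ₃₆`**, **`eq_etaProductThirtySix_of_isNewform0`** (the only newform of level `36`)
and **`f_eq_etaProductThirtySix`: every `X₀(36)`-datum of every curve has `D.f = φ₃₆`**; finally
`cuspForm_thirtySix_eq_zero_of_tendsto` (`S ∈ S₂(Γ₀(36))`, `S/q → 0` ⟹ `S = 0`), the uniqueness input
of the `η`-identity reduction at level `36`.

HONEST FRAMING: everything here is unconditional (standard axioms); nothing here computes a Manin
constant or proves C2, C3, Manin's conjecture or BSD; the items stay OPEN as filed.  No definition, no
named fact, no sorry.
[cite: CremonaAlgorithms1997, Table 3 (N = 36)] [cite: DiamondShurman2005, Thm. 3.5.1, Def. 5.8.1, Prop. 5.8.4]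
[cite: Koehler2011, §1]
-/

set_option autoImplicit false
-- lint-debt: the directory name repeats the summit name (sibling precedent `ManinLocalTwoThreeManinPrimeToThreeAtNineInhabited.lean`)
set_option linter.dupNamespace false

noncomputable section

open scoped MatrixGroups ModularForm Topology Real
open Filter CongruenceSubgroup WeierstrassCurve Function Complex
open UpperHalfPlane hiding I
open Literature.NumberTheory.EllipticCurves Literature.NumberTheory.EllipticCurves.ModularForms

namespace Summit.BirchSwinnertonDyer.BirchSwinnertonDyer.Theorems.ManinLocalTwoThree.NewformThirtySix

/-! ## §1 FACT-FREE: the newform at level `36` is `φ₃₆ = η(6τ)⁴` -/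

/-- The exponent vector of `η(6τ)⁴` as an `η`-quotient of level `36` (`r₆ = 4`, else `0`). [cite: Koehler2011, §1] -/
theorem etaQuotient_six_eq_etaProductThirtySix (τ : ℍ) :
    etaQuotient 36 (expFn [(6, 4)]) τ = etaProductThirtySix τ := by
  have h : etaQuotient 36 (expFn [(6, 4)]) τ = η (6 * (τ : ℂ)) ^ 4 := by
    rw [etaQuotient_apply, show Nat.divisors 36 = {1, 2, 3, 4, 6, 9, 12, 18, 36} by decide]
    rw [Finset.prod_insert (by decide), Finset.prod_insert (by decide), Finset.prod_insert (by decide),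
      Finset.prod_insert (by decide), Finset.prod_insert (by decide), Finset.prod_insert (by decide),
      Finset.prod_insert (by decide), Finset.prod_insert (by decide), Finset.prod_singleton]
    rw [show expFn [(6, 4)] 1 = 0 by decide, show expFn [(6, 4)] 2 = 0 by decide,
      show expFn [(6, 4)] 3 = 0 by decide, show expFn [(6, 4)] 4 = 0 by decide,
      show expFn [(6, 4)] 6 = 4 by decide, show expFn [(6, 4)] 9 = 0 by decide,
      show expFn [(6, 4)] 12 = 0 by decide, show expFn [(6, 4)] 18 = 0 by decide,
      show expFn [(6, 4)] 36 = 0 by decide]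
    simp only [zpow_zero, one_mul, mul_one]
    norm_cast
  rw [h, etaProductThirtySix_apply]
  ring

/-- **`φ₃₆(τ)/q → 1` at `i∞`**: the order of `η(6τ)⁴` at `∞` is `6·4/24 = 1` with leading coefficient `1`.
[cite: Koehler2011, §1] -/
theorem tendsto_etaProductThirtySix_div_qParam :
    Tendsto (fun τ : ℍ ↦ cuspFormEtaProductThirtySix τ / Periodic.qParam 1 (τ : ℂ)) atImInfty (𝓝 1) := by
  have h := tendsto_etaQuotient_div_qParam_zpow 36 (expFn [(6, 4)]) 1 (by decide)
  refine h.congr fun τ ↦ ?_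
  rw [zpow_one, etaQuotient_six_eq_etaProductThirtySix]
  rfl

/-- **`a₁(φ₃₆) = 1`**: `η(6τ)⁴ = q − 4q⁷ + 2q¹³ + ⋯` is normalised. [cite: CremonaAlgorithms1997, Table 3 (N = 36)] -/
theorem cuspCoeff_one_etaProductThirtySix : cuspCoeff cuspFormEtaProductThirtySix 1 = 1 :=
  NonVacuityTwentySeven.cuspCoeff_one_eq_of_tendsto _ tendsto_etaProductThirtySix_div_qParam

/-- **`S₂(Γ₀(M)) = 0` for every proper divisor `M` of `36`** (`M ∈ {1, 2, 3, 4, 6, 9, 12, 18}`: the curves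
`X₀(M)` have genus `0`; tree: `dim S₂(Γ₀(M)) = g(X₀(M))` at these levels and the genus table).
[cite: DiamondShurman2005, Thm. 3.5.1] -/
theorem cuspForm_two_eq_zero_of_mem_properDivisors_thirtySix {M : ℕ} [NeZero M]
    (hM : M ∈ Nat.properDivisors 36) (g : CuspForm (Gamma0 M) 2) : g = 0 := by
  have hfd : FiniteDimensional ℂ (CuspForm (Gamma0 M) 2) := finiteDimensional_cuspForm_gamma0 M 2
  rw [show Nat.properDivisors 36 = {1, 2, 3, 4, 6, 9, 12, 18} by decide] at hM
  simp only [Finset.mem_insert, Finset.mem_singleton] at hM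
  have h1 : finrank_cuspForm_two_eq_genusX0 M :=
    finrank_cuspForm_two_eq_genusX0_of_mem_levels₂ (by
      simp only [Finset.mem_insert, Finset.mem_singleton]; omega)
  have h2 : genusX0 M = 0 :=
    genusX0_eq_zero_of_mem_genusZeroLevels (by simp only [Finset.mem_insert, Finset.mem_singleton]; omega)
  unfold finrank_cuspForm_two_eq_genusX0 at h1
  rw [h2] at h1
  exact (finrank_zero_iff_forall_zero.mp h1) g

/-- **Every weight-`2` cusp form of level `36` is new** (the adjoint degeneracy maps land in
`S₂(Γ₀(M)) = 0`, `M` a proper divisor of `36`). [cite: DiamondShurman2005, §5.6] -/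
theorem mem_newSubspace0_thirtySix (f : CuspForm (Gamma0 36) 2) : f ∈ newSubspace0 36 2 := by
  rw [newSubspace0, Submodule.mem_iInf]
  intro Md
  rw [LinearMap.mem_ker]
  exact cuspForm_two_eq_zero_of_mem_properDivisors_thirtySix Md.2.1 _

/-- **Every non-zero `f ∈ S₂(Γ₀(36))` is a Hecke eigenform** (the space is a line stable under every `T_p`).
[cite: DiamondShurman2005, Prop. 5.8.4] -/
theorem isHeckeEigenform_of_ne_zero_thirtySix {f : CuspForm (Gamma0 36) 2} (hf : f ≠ 0) :
    IsHeckeEigenform f := by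
  intro p hp
  haveI : NeZero p := ⟨hp.ne_zero⟩
  obtain ⟨c, hc⟩ := (finrank_eq_one_iff_of_nonzero' f hf).mp
    finrank_cuspForm_two_eq_genusX0_thirtySix.2.1 (heckeT _ 2 p f)
  exact ⟨c, hc.symm⟩

/-- **`φ₃₆ = η(6τ)⁴` is a newform of weight `2` on `Γ₀(36)`** — FACT-FREE. [cite: CremonaAlgorithms1997, Table 3 (N = 36)] -/
theorem isNewform0_etaProductThirtySix : IsNewform0 cuspFormEtaProductThirtySix :=
  ⟨mem_newSubspace0_thirtySix _, isHeckeEigenform_of_ne_zero_thirtySix cuspFormEtaProductThirtySix_ne_zero,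
    cuspCoeff_one_etaProductThirtySix⟩

/-- **Uniqueness: every newform of weight `2` on `Γ₀(36)` is `φ₃₆`.** [cite: CremonaAlgorithms1997, Table 3 (N = 36)] -/
theorem eq_etaProductThirtySix_of_isNewform0 {g : CuspForm (Gamma0 36) 2} (hg : IsNewform0 g) :
    g = cuspFormEtaProductThirtySix := by
  obtain ⟨c, hc⟩ := (finrank_eq_one_iff_of_nonzero' cuspFormEtaProductThirtySix
    cuspFormEtaProductThirtySix_ne_zero).mp finrank_cuspForm_two_eq_genusX0_thirtySix.2.1 g
  have h1 : cuspCoeff g 1 = 1 := hg.2.2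
  have hc1 : c = 1 := by
    have h := congrArg (cuspCoeff · 1) hc
    simp only [cuspCoeff_smul, h1, cuspCoeff_one_etaProductThirtySix, mul_one] at h
    exact h
  rw [← hc, hc1, one_smul]

/-- **Every `X₀(36)`-datum of every curve has newform `φ₃₆ = η(6τ)⁴`.** FACT-FREE. [cite: CremonaAlgorithms1997, Table 3 (N = 36)] -/
theorem f_eq_etaProductThirtySix {W : WeierstrassCurve ℚ} (D : ModularParametrizationData W 36) :
    D.f = cuspFormEtaProductThirtySix :=
  eq_etaProductThirtySix_of_isNewform0 D.isNewformOf.1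

/-- **`S ∈ S₂(Γ₀(36))` with `S(τ)/q → 0` at `i∞` is zero** (`S = c·φ₃₆` and `φ₃₆/q → 1`). [folklore] -/
theorem cuspForm_thirtySix_eq_zero_of_tendsto (S : CuspForm (Gamma0 36) 2)
    (h : Tendsto (fun τ : ℍ ↦ S τ / Periodic.qParam 1 (τ : ℂ)) atImInfty (𝓝 0)) : S = 0 := by
  obtain ⟨c, hc⟩ := finrank_cuspForm_two_eq_genusX0_thirtySix.2.2 S
  have hlim : Tendsto (fun τ : ℍ ↦ S τ / Periodic.qParam 1 (τ : ℂ)) atImInfty (𝓝 c) := by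
    have := tendsto_etaProductThirtySix_div_qParam.const_mul c
    rw [mul_one] at this
    refine this.congr fun τ ↦ ?_
    rw [← hc, CuspForm.IsGLPos.smul_apply, smul_eq_mul, mul_div_assoc]
  have hc0 : c = 0 := tendsto_nhds_unique hlim h
  rw [← hc, hc0, zero_smul]

end Summit.BirchSwinnertonDyer.BirchSwinnertonDyer.Theorems.ManinLocalTwoThree.NewformThirtySix

end
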